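import Summits.BirchSwinnertonDyer.BirchSwinnertonDyer.Theorems.InertBadSignedBranchesInertBadAtThreeHeartStubV2
import Summits.BirchSwinnertonDyer.BirchSwinnertonDyer.Theorems.BiquadraticEisensteinDescentDeuringRowZeroHolds
import HarnessLib

set_option linter.dupNamespace false -- `Summit.BirchSwinnertonDyer.BirchSwinnertonDyer.Theorems.…` (summit = sub, D-0017)
set_option autoImplicit false

/-!
# Crux `InertBadAtThree` (stmt-BirchSwinnertonDyer-19225): the tied Katz frame at `p = 3`
# MODULO THE KATZ–HIDA–TILOUINE EXISTENCE FACT ALONE (Deuring's theorem is now a kernel theorem)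

Route `BiquadraticEisensteinDescent` (cell `pub/bsd-wall`, width seat `bsd-wall-cm-bed-w1` g16). THEOREMS ONLY; supports, does not
close, stmt-BirchSwinnertonDyer-19225. `stub_tiedKatzFrameAtThree_of_katz (hKatz : hsieh2014mu_prop49_exists_isMeasure) :` the
statement of `…InertBadAtThreeHeartStubV2.stub_tiedKatzFrameAtThree_of_katz_of_deuring` VERBATIM with its second named-fact hypothesis
`Deuring_exists_heckeCharacter_of_maximalCM` DISCHARGED by the lane's theorem `Deuring_exists_heckeCharacter_of_maximalCM_holds`
(«Deuring-ψ lane», seats w1–w4 g12–g18). So the group (E) «Katz ∧ Deuring» of the line's held print stub `PrintedInputsAtThreeMin`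
(skeleton `rubin_e1_inert_three` v8) shrinks to Katz 1978 (5.3.0) / Hida–Tilouine 1993 Thm. II / Hsieh 2014 Prop. 4.9 alone —
a reshape note for the line's lead. HONEST STATUS: nothing about `stub_katzLineDivisibilityAtThree` or any case of BSD is asserted;
19225 stays OPEN.
-/

noncomputable section

open scoped Classical NumberField IntermediateField
open NumberField IsDedekindDomain Module CongruenceSubgroup WeierstrassCurve IntermediateField Field PowerSeries
open Literature.NumberTheory.EllipticCurves Literature.NumberTheory.GaloisRepresentations
open Literature.NumberTheory.EllipticCurves.ModularForms Literature.NumberTheory.EllipticCurves.Rank1Residual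

namespace Summit.BirchSwinnertonDyer.BirchSwinnertonDyer.Theorems.InertBadSignedBranchesInertBadAtThreeHeartStubV2OfKatz

/-- **The tied Katz line frame at `p = 3`, GIVEN ONLY the Katz–Hida–Tilouine existence fact** — statement of
`stub_tiedKatzFrameAtThree_of_katz_of_deuring` verbatim; Deuring's theorem supplied by the kernel theorem
`Deuring_exists_heckeCharacter_of_maximalCM_holds`. [cite: Hsieh2014mu, Prop. 4.9 (§4.8)] [cite: Katz1978, (5.3.0)]
[cite: HidaTilouine1993, Thm. II] [cite: SilvermanATAEC1994, Ch. II Thm. 9.2 and Thm. 10.5 (b)] -/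
theorem stub_tiedKatzFrameAtThree_of_katz (hKatz : hsieh2014mu_prop49_exists_isMeasure) :
    ∀ (W : WeierstrassCurve ℚ) [W.IsElliptic] [W.IsGloballyMinimal] (p : ℕ) [Fact p.Prime]
      [NeZero (W.conductorNorm ℤ)] (K : Type) [Field K] [NumberField K],
      W.HasCM → p = 3 → CMInert W p → ¬ Good W p →
      IsImaginaryQuadratic K → SatisfiesHeegnerHypothesis (W.conductorNorm ℤ) K →
      4 < (NumberField.discr K).natAbs → ¬ p ∣ NumberField.classNumber K →
      ∀ (κ : ZpExtension K p), κ.IsAnticyclotomic →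
        ∀ (γ : Field.absoluteGaloisGroup K) [Fact (κ.IsTopGenerator γ)]
          (𝔭 : HeightOneSpectrum (𝓞 K)), ((p : ℕ) : 𝓞 K) ∈ 𝔭.asIdeal →
          𝔭.asIdeal.ramificationIdx (𝓞 ℚ) = 1 → 𝔭.asIdeal.inertiaDeg (𝓞 ℚ) = 1 →
          ∀ (f : CuspForm (CongruenceSubgroup.Gamma0 (W.conductorNorm ℤ)) 2), IsNewformOf W f →
            ∀ (ι' : PadicAlgCl p ≃+* ℂ),
              (∀ (w : InfinitePlace K) (k : 𝓞 K), k ∈ 𝔭.asIdeal ↔ ‖ι'.symm (w.embedding (k : K))‖ < 1) →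
                  ∀ (𝔭' : HeightOneSpectrum (𝓞 K)), ((p : ℕ) : 𝓞 K) ∈ 𝔭'.asIdeal → 𝔭' ≠ 𝔭 →
                  ∃ (L : Type) (_ : Field L) (_ : NumberField L) (_ : Algebra K L) (_ : IsGalois K L)
                    (Sp S T : Finset (HeightOneSpectrum (𝓞 L))) (lam : HeckeCharacter L) (ϑ : L) (CK : ℂ)
                    (Ω : InfinitePlace L → ℂ) (ΩpK : InfinitePlace L → ℂ_[p]) (G : PowerSeries 𝓞_ℂ_[p])
                    (w₁ w₂ : InfinitePlace L) (cL cL' : ℂ),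
                    w₁ ≠ w₂ ∧ (∀ w : InfinitePlace L, w = w₁ ∨ w = w₂) ∧
                    (∀ (χ : HeckeCharacter K) (n : ℕ), 0 < n → (∀ v : HeightOneSpectrum (𝓞 K), χ.IsUnramifiedAt v) →
                      χ.HasInfinityType (fun _ ↦ (n : ℤ)) (fun _ ↦ -(n : ℤ)) →
                      KatzCM.HasKatzType ι' Sp (lam * χ.compRelNorm L) 1 (fun w ↦ if w = w₁ then n else n - 1)) ∧
                    (∀ (χ : HeckeCharacter K) (n : ℕ), 0 < n → (∀ v : HeightOneSpectrum (𝓞 K), χ.IsUnramifiedAt v) →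
                      χ.HasInfinityType (fun _ ↦ (n : ℤ)) (fun _ ↦ -(n : ℤ)) →
                      LFunction.HasEntireContinuation (heckeLFunction (lam * χ.compRelNorm L))) ∧
                    cL ≠ 0 ∧ cL' ≠ 0 ∧
                    (∀ (χ : HeckeCharacter K) (n : ℕ), 0 < n → (∀ v : HeightOneSpectrum (𝓞 K), χ.IsUnramifiedAt v) →
                      χ.HasInfinityType (fun _ ↦ (n : ℤ)) (fun _ ↦ -(n : ℤ)) →
                      ∀ hL : LFunction.HasEntireContinuation (heckeLFunction (lam * χ.compRelNorm L)),
                        hL.continuation 0 = cL * cL' ^ n * rankinSelbergValueHecke f χ 1) ∧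
                    (∀ w ∈ S ∪ KatzCM.primesOver L p, ¬ lam.IsUnramifiedAt w) ∧
                    (∀ w ∈ Sp ∪ T, ¬ lam.IsUnramifiedAt w) ∧
                    CK ≠ 0 ∧ (∀ w, Ω w ≠ 0) ∧ (∀ w, (KatzCM.embeddingAt ι' Sp w ϑ).im ≠ 0) ∧ (∀ w, ΩpK w ≠ 0) ∧
                    KatzCM.IsBaseChangeLine ι' Sp S T κ γ lam ϑ CK Ω ΩpK G :=
  Summit.BirchSwinnertonDyer.BirchSwinnertonDyer.Theorems.InertBadSignedBranchesInertBadAtThreeHeartStubV2.stub_tiedKatzFrameAtThree_of_katz_of_deuring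
    hKatz Summit.BirchSwinnertonDyer.BirchSwinnertonDyer.Theorems.BiquadraticEisensteinDescentDeuringOfCore.Deuring_exists_heckeCharacter_of_maximalCM_holds

end Summit.BirchSwinnertonDyer.BirchSwinnertonDyer.Theorems.InertBadSignedBranchesInertBadAtThreeHeartStubV2OfKatz

end
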